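import Literature.Probability.Percolation.KestenRelationRusso
import Literature.Probability.Percolation.NearCriticalScaling
import Literature.Probability.Percolation.TriHexExclusive
import Literature.Probability.Percolation.TriSubcriticalCrossing
import HarnessLib

/-!
# Kesten's relation and `θ(p) = (p - 1/2)^{5/36 + o(1)}`: discharges and assembly (proofs only)

Topic `Literature/Probability/Percolation`; family `crit-perc`, statement **crit-perc.S16**
(`Literature.Probability.Percolation.triTheta_exponent`, Smirnov–Werner 2001, Thm. 1 / Kesten 1987). Sibling proof file
of `KestenRelationRusso.lean` (no new definitions, no new named facts):

* `BollobasRiordan2006_ch5_lemma7_holds` — the named fact `BollobasRiordan2006_ch5_lemma7`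
  (`P_{1/2}(𝒞_H([0, n]²)) = 1/2` for every `n`; Bollobás–Riordan 2006, Ch. 5, Lemma 7) now HOLDS:
  it is the tree's `Literature.Probability.Percolation.triLRCrossingProb_half_self` (`TriHexExclusive.lean`: the Hex
  theorem — existence half `TriHexLemma.lean`, exclusivity half `TriHexExclusive.lean` — plus the
  colour-exchange and diagonal-reflection symmetries).
* `Nolin2008_subcritical_crossing_of_expDecay` — the named fact `Nolin2008_subcritical_crossing`
  (`P_p(𝒞_H([0, n]²)) → 0` for `p < 1/2`; Nolin 2008, §3.1) follows from the exponential decay of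
  the radius below `1/2` (`BollobasRiordan2006_tri_expDecay`, `TriSubcriticalCrossing.lean`:
  `P_p(𝒞_H([0, n]²)) ≤ (n + 1) P_p(0 ↔ ∂Λ_n)`).
* `Nolin2008_prop34_of_expDecay` — Kesten's relation `|p - 1/2| L(p)² π₄(L(p)) ≍ 1`
  (`Nolin2008_prop34`) from the two remaining leaves of its Russo-formula proof
  (`Nolin2008_prop34_of_russo`): exponential decay below `1/2` and the pivotal count below `L(p)`
  (`Werner2009_lemma62`).
* `triTheta_exponent_of_leaves` — the resulting form of the assembly of `triTheta_exponent` from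
  its six remaining leaves:
  `oneArm_exponent` (Lawler–Schramm–Werner 2002: `π₁(n) = n^{-5/48+o(1)}`),
  `fourArm_exponent` (Smirnov–Werner 2001: `π₄(n) = n^{-5/4+o(1)}`),
  `BollobasRiordan2006_tri_expDecay` (exponential decay of the radius below `p_c^site(𝕋) = 1/2`;
  Bollobás–Riordan 2006, Ch. 4, Thm. 9 with Ch. 5, Thm. 8),
  `Werner2009_lemma62` (`Σ_x P_t(x pivotal) ≍ N² π₄(N)` below `L(p)`; Werner 2009, Lecture 6,
  Lemmas 6.2–6.3),
  `Nolin2008_thm27_oneArm` (near-critical stability of the one-arm probability; Nolin 2008,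
  Thm. 27; Kesten 1987) and
  `Nolin2008_cor41` (`θ(p) ≥ c P_p(0 ↔ ∂Λ_{L(p)})`; Nolin 2008, Cor. 41),
  through `triTheta_exponent_of_scaling` (`KestenScaling.lean`, the real-analysis core:
  `L(p) = |p - 1/2|^{-4/3+o(1)}`, then `θ(p) = (p - 1/2)^{5/36+o(1)}`; Smirnov–Werner 2001, §2;
  Nolin 2008, §7.4; Werner 2009, Lecture 6, "End of the proof of the theorem").
* Symmetry about `1/2` of the pivotal count (Nolin 2008, proof of Prop. 34, first sentence: "For
  symmetry reasons, we can assume that `p > 1/2`"): the pivotality lemmas `isPivotal_compl_iff`,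
  `isPivotal_compl_config_iff`, `isPivotal_relabel_iff` (pivotality under complementation of the
  event, colour exchange of the configuration, relabelling of the sites), the set form of the Hex
  lemma `compl_triLRCrossing_eq`, and from them `real_isPivotal_triLRCrossing_symm`
  (`P_{1-t}(v pivotal) = P_t(vᵀ pivotal)`, `vᵀ` the reflection of `v` in the diagonal of the
  rhombus) and `rhombusPivotalSum_symm` (`rhombusPivotalSum (1 - t) N = rhombusPivotalSum t N`);
  hence `Werner2009_lemma62_of_half_le` — the named fact `Werner2009_lemma62` (two-sided in `t`)
  follows from its verbatim restriction to `1/2 ≤ t < 1/2 + δ`, the side on which Werner's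
  Lecture 6 and the tree's near-critical facts (`WernerPivotalEstimates.lean`,
  `NearCriticalFourArmFacts.lean`, `NearCriticalBoundaryFacts.lean`) are stated — and
  `charLength_anti` (`L_ε ≤ L_{ε'}` for `ε' ≤ ε`, Nolin 2008, proof of Cor. 35), by which facts
  recorded "for every small enough `ε`" below `L_ε` serve every `ε ∈ (0, 1/2)`.

## References

* B. Bollobás, O. Riordan, *Percolation*, CUP 2006, Ch. 5, Lemma 7 and Thm. 8 [BollobasRiordan2006].
* P. Nolin, Near-critical percolation in two dimensions, *Electron. J. Probab.* 13 (2008), §3.1,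
  §7.3–7.4 [Nolin2008].
* W. Werner, Lectures on two-dimensional critical percolation, PCMI (2009), Lecture 6
  [WernerPCMI2009].
* S. Smirnov, W. Werner, *Math. Res. Lett.* 8 (2001), §2 [SmirnovWernerMRL2001].
-/

noncomputable section

namespace Literature.Probability.Percolation

/-- **Self-duality of the rhombus holds**: `P_{1/2}(𝒞_H([0, n]²)) = 1/2` for every `n`
(Bollobás–Riordan 2006, Ch. 5, Lemma 7; Nolin 2008, §3.1), discharging the named fact
`BollobasRiordan2006_ch5_lemma7` by the tree's `Literature.Probability.Percolation.triLRCrossingProb_half_self`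
(`TriHexExclusive.lean`). [cite: BollobasRiordan2006, Ch. 5, Lemma 7] [cite: Nolin2008, §3.1] -/
theorem BollobasRiordan2006_ch5_lemma7_holds : BollobasRiordan2006_ch5_lemma7 :=
  fun n => Literature.Probability.Percolation.triLRCrossingProb_half_self n

/-- **Sub-critical decay of rhombus crossings from the exponential decay of the radius**: the
named fact `Nolin2008_subcritical_crossing` (Nolin 2008, §3.1) follows from
`BollobasRiordan2006_tri_expDecay`
(`TriSubcriticalCrossing.triLRCrossingProb_tendsto_zero_of_expDecay`). [cite: Nolin2008, §3.1] [cite: BollobasRiordan2006, Ch. 5, proof of Thm. 8] -/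
theorem Nolin2008_subcritical_crossing_of_expDecay (hdec : BollobasRiordan2006_tri_expDecay) :
    Nolin2008_subcritical_crossing :=
  fun p hp => triLRCrossingProb_tendsto_zero_of_expDecay hdec p hp

/-- **Kesten's relation `|p - 1/2| L(p)² π₄(L(p)) ≍ 1` from its two remaining leaves**
(exponential decay below `1/2`, pivotal count below `L(p)`), through `Nolin2008_prop34_of_russo`
with the self-duality of the rhombus now proved. [cite: Nolin2008, §7.3, Prop. 34 (arXiv 0711.4948: Prop. 32)] [cite: WernerPCMI2009, Lecture 6, Cor. 6.3 and display after Lemma 6.3] -/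
theorem Nolin2008_prop34_of_expDecay (hdec : BollobasRiordan2006_tri_expDecay)
    (h62 : Werner2009_lemma62) : Nolin2008_prop34 :=
  Nolin2008_prop34_of_russo BollobasRiordan2006_ch5_lemma7_holds
    (Nolin2008_subcritical_crossing_of_expDecay hdec) h62

/-- **crit-perc.S16 from its six current leaves**: `θ(p) = (p - 1/2)^{5/36 + o(1)}` as
`p ↓ 1/2` (Smirnov–Werner 2001, Thm. 1; Kesten 1987), assembled from the two critical arm
exponents, the exponential decay of the radius below `1/2`, the pivotal count below `L(p)`, and
the two near-critical one-arm facts. When each leaf `X` has its `X_holds`,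
`triTheta_exponent_holds` is this theorem applied to them. [cite: SmirnovWernerMRL2001, §2 (paragraph after the theorem "Behaviour near the critical point")] [cite: WernerPCMI2009, Lecture 6, "End of the proof of the theorem"] -/
theorem triTheta_exponent_of_leaves (h₁ : oneArm_exponent) (h₄ : fourArm_exponent)
    (hdec : BollobasRiordan2006_tri_expDecay) (h62 : Werner2009_lemma62)
    (h27 : Nolin2008_thm27_oneArm) (h41 : Nolin2008_cor41) : triTheta_exponent :=
  triTheta_exponent_of_scaling h₁ h₄ (Nolin2008_prop34_of_expDecay hdec h62)
    (Nolin2008_theta_asymp_of_nearCritical h27 h41)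

/-! ### Symmetries of pivotality: colour exchange and transposition

Nolin 2008, proof of Prop. 34 [arXiv 0711.4948: Prop. 32], first sentence: "For symmetry reasons,
we can assume that `p > 1/2`." For the rhombus `[0, N]²` the expected number of pivotal sites of
`𝒞_H` is the same at `t` and at `1 - t`: exchanging the colours maps `P_t` to `P_{1-t}` and the
sites pivotal for the open left–right crossing to the sites pivotal for the closed left–right
crossing, i.e. (Hex lemma) for the open top–bottom crossing, which the reflection of the rhombus
in its diagonal maps back to the open left–right crossing. Consequently the two-sided
(`|t - 1/2| < δ`) statement `Werner2009_lemma62` follows from its restriction to `t ≥ 1/2`, the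
side on which Werner's Lecture 6 (and the tree's near-critical named facts) are stated. -/

section PivotalSymm

variable {ι : Type*}

/-- Pivotality for an event and for its complement coincide. [folklore] -/
theorem isPivotal_compl_iff (A : Set (Set ι)) (i : ι) (ω : Set ι) :
    IsPivotal Aᶜ i ω ↔ IsPivotal A i ω := by
  unfold IsPivotal Xor
  simp only [Set.mem_compl_iff]
  tauto

/-- **Colour exchange and pivotality**: `i` is pivotal for `A` in the complemented configuration
`ωᶜ` iff it is pivotal for the colour-exchanged event `{ω | ωᶜ ∈ A}` in `ω` (the two modified
configurations `ωᶜ ∪ {i}`, `ωᶜ ∖ {i}` are the complements of `ω ∖ {i}`, `ω ∪ {i}`). [folklore] -/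
theorem isPivotal_compl_config_iff (A : Set (Set ι)) (i : ι) (ω : Set ι) :
    IsPivotal A i ωᶜ ↔ IsPivotal (compl ⁻¹' A) i ω := by
  have h1 : insert i ωᶜ = (ω \ {i})ᶜ := by
    ext j
    simp only [Set.mem_insert_iff, Set.mem_compl_iff, Set.mem_sdiff, Set.mem_singleton_iff]
    tauto
  have h2 : ωᶜ \ {i} = (insert i ω)ᶜ := by
    ext j
    simp only [Set.mem_insert_iff, Set.mem_compl_iff, Set.mem_sdiff, Set.mem_singleton_iff]
    tauto
  unfold IsPivotal Xor
  rw [h1, h2, Set.mem_preimage, Set.mem_preimage]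
  tauto

/-- Set form of `isPivotal_compl_config_iff`. [folklore] -/
theorem preimage_compl_setOf_isPivotal (A : Set (Set ι)) (i : ι) :
    compl ⁻¹' {ω : Set ι | IsPivotal A i ω} = {ω | IsPivotal (compl ⁻¹' A) i ω} := by
  ext ω
  exact isPivotal_compl_config_iff A i ω

/-- **Relabelling and pivotality**: for a bijection `e`, the site `e i` is pivotal for `A` in the
relabelled configuration `e '' ω` iff `i` is pivotal for the pulled-back event in `ω`. [folklore] -/
theorem isPivotal_relabel_iff {W : Type*} (e : ι ≃ W) (A : Set (Set W)) (i : ι) (ω : Set ι) :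
    IsPivotal A (e i) (SiteConfig.relabel e ω) ↔ IsPivotal (SiteConfig.relabel e ⁻¹' A) i ω := by
  have h1 : insert (e i) ((e : ι → W) '' ω) = (e : ι → W) '' (insert i ω) := Set.image_insert_eq.symm
  have h2 : ((e : ι → W) '' ω) \ {e i} = (e : ι → W) '' (ω \ {i}) := by
    rw [Set.image_sdiff e.injective, Set.image_singleton]
  unfold IsPivotal
  simp only [SiteConfig.relabel_apply, Set.mem_preimage, h1, h2]

/-- Set form of `isPivotal_relabel_iff`. [folklore] -/
theorem preimage_relabel_setOf_isPivotal {W : Type*} (e : ι ≃ W) (A : Set (Set W)) (i : ι) :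
    SiteConfig.relabel e ⁻¹' {ω' : Set W | IsPivotal A (e i) ω'} =
      {ω | IsPivotal (SiteConfig.relabel e ⁻¹' A) i ω} := by
  ext ω
  exact isPivotal_relabel_iff e A i ω

end PivotalSymm

open LatticeModels Set
open scoped unitInterval

/-- **Hex lemma, set form**: the complement of the open left–right crossing of `R(m, n)` is the
closed top–bottom crossing (Bollobás–Riordan 2006, Ch. 5, Lemma 7: exactly one of `H(R)`, `V*(R)`
occurs; existence `triLRCrossing_or_compl_triTBCrossing`, exclusivity
`disjoint_triLRCrossing_compl_preimage_triTBCrossing`). [cite: BollobasRiordan2006, Ch. 5, Lemma 7] -/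
theorem compl_triLRCrossing_eq (m n : ℕ) :
    (triLRCrossing m n)ᶜ = compl ⁻¹' triTBCrossing m n := by
  refine Set.Subset.antisymm (fun ω hω => ?_) fun ω hω hω' => ?_
  · exact (triLRCrossing_or_compl_triTBCrossing m n ω).resolve_left hω
  · exact Set.disjoint_left.1 (disjoint_triLRCrossing_compl_preimage_triTBCrossing m n) hω' hω

/-- **Colour exchange and transposition for pivotal sites of the rhombus**:
`P_{1-t}(v is pivotal for 𝒞_H([0,N]²)) = P_t(v' is pivotal for 𝒞_H([0,N]²))`, `v' = (v₁, v₀)` the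
reflection of `v` in the diagonal: `P_{1-t}` is the image of `P_t` under `ω ↦ ωᶜ`
(`sitePercolation_real_preimage_compl`), which carries pivotality for the open left–right crossing
to pivotality for the closed one, i.e. (Hex lemma, `compl_triLRCrossing_eq`, and
`isPivotal_compl_iff`) for the open top–bottom crossing `triTBCrossing N N`, the transpose of
`triLRCrossing N N` (`relabel_transpose_preimage_triLRCrossing`); `P_t` is transposition invariant
(`sitePercolation_real_preimage_relabel`). (Nolin 2008, proof of Prop. 34: "For symmetry reasons, we
can assume that `p > 1/2`".) [cite: Nolin2008, §7.3, proof of Prop. 34, first sentence (arXiv 0711.4948: Prop. 32)] -/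
theorem real_isPivotal_triLRCrossing_symm (t : unitInterval) (N : ℕ) (v : Site 2) :
    (triSitePercolation (σ t)).real {ω | IsPivotal (triLRCrossing N N) v ω} =
      (triSitePercolation t).real {ω | IsPivotal (triLRCrossing N N) (transposeIso v) ω} := by
  have hA : (compl ⁻¹' triLRCrossing N N : Set (SiteConfig (Site 2)))ᶜ = triTBCrossing N N := by
    rw [← Set.preimage_compl, compl_triLRCrossing_eq, Set.preimage_preimage]
    conv_rhs => rw [← Set.preimage_id (s := triTBCrossing N N)]
    congr 1
    funext ω
    exact compl_compl ω
  calc (triSitePercolation (σ t)).real {ω | IsPivotal (triLRCrossing N N) v ω}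
      = (triSitePercolation t).real (compl ⁻¹' {ω | IsPivotal (triLRCrossing N N) v ω}) := by
        rw [triSitePercolation, triSitePercolation, sitePercolation_real_preimage_compl]
    _ = (triSitePercolation t).real {ω | IsPivotal (triTBCrossing N N) v ω} := by
        rw [preimage_compl_setOf_isPivotal]
        congr 1
        ext ω
        rw [Set.mem_setOf_eq, Set.mem_setOf_eq, ← isPivotal_compl_iff (compl ⁻¹' triLRCrossing N N), hA]
    _ = (triSitePercolation t).real
          (SiteConfig.relabel transposeIso.toEquiv ⁻¹'
            {ω' | IsPivotal (triLRCrossing N N) (transposeIso v) ω'}) := by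
        rw [← relabel_transpose_preimage_triLRCrossing N N]
        exact congrArg _ (preimage_relabel_setOf_isPivotal transposeIso.toEquiv _ v).symm
    _ = (triSitePercolation t).real {ω | IsPivotal (triLRCrossing N N) (transposeIso v) ω} := by
        rw [triSitePercolation, sitePercolation_real_preimage_relabel]

/-- The transposition maps the rhombus `R(N, N)` to itself. [folklore] -/
theorem transposeIso_mem_rectangle_self {N : ℕ} {v : Site 2} (hv : v ∈ rectangle N N) :
    transposeIso v ∈ rectangle N N := by
  rw [mem_rectangle_iff] at hv ⊢
  rw [transposeIso_apply_zero, transposeIso_apply_one]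
  tauto

/-- **The expected number of pivotal sites of the rhombus crossing is symmetric about `1/2`**:
`Σ_{v ∈ [0,N]²} P_{1-t}(v pivotal for 𝒞_H([0,N]²)) = Σ_{v ∈ [0,N]²} P_t(v pivotal for 𝒞_H([0,N]²))`
(colour exchange, the Hex lemma and the reflection of the rhombus in its diagonal,
`real_isPivotal_triLRCrossing_symm`, the reflection permuting the sites of the rhombus). This is the
symmetry invoked at the start of Nolin's proof of Prop. 34 ("For symmetry reasons, we can assume that
`p > 1/2`") and implicit in Werner's Lecture 6, where `p ≥ 1/2` throughout. [cite: Nolin2008, §7.3, proof of Prop. 34, first sentence (arXiv 0711.4948: Prop. 32)] -/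
theorem rhombusPivotalSum_symm (t : unitInterval) (N : ℕ) :
    rhombusPivotalSum (σ t) N = rhombusPivotalSum t N := by
  unfold rhombusPivotalSum
  simp_rw [real_isPivotal_triLRCrossing_symm t N]
  exact Finset.sum_nbij' (fun v => transposeIso v) (fun v => transposeIso v)
    (fun v hv => transposeIso_mem_rectangle_self hv) (fun v hv => transposeIso_mem_rectangle_self hv)
    (fun v _ => transposeIso_transposeIso v) (fun v _ => transposeIso_transposeIso v) fun v _ => rfl

/-- **`Werner2009_lemma62` from its restriction to `t ≥ 1/2`** (Nolin 2008, proof of Prop. 34: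
"For symmetry reasons, we can assume that `p > 1/2`"; Werner 2009, Lecture 6, §2: bounds "uniformly
for all `p ≥ 1/2` and `n ≤ L(p)`"): if the pivotal count `Σ_{v ∈ [0,N]²} P_t(v pivotal) ≍ N² π₄(N)`
holds for `1/2 ≤ t < 1/2 + δ` and `n₁ ≤ N ≤ L_ε(t)` (no upper restriction at `t = 1/2`), then it
holds for `|t - 1/2| < δ`, by `rhombusPivotalSum_symm` and `L_ε(1 - t) = L_ε(t)` (`charLength_symm`).
The hypothesis is the verbatim one-sided form of the named fact, in the shape of the tree's
near-critical facts (`Werner2009_lemma62P`, `Werner2009_lemma63`, …: `1/2 ≤ t < 1/2 + δ`,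
`1/2 < t → N ≤ L`). [cite: Nolin2008, §7.3, proof of Prop. 34, first sentence (arXiv 0711.4948: Prop. 32)] [cite: WernerPCMI2009, Lecture 6, §2 ("uniformly for all p ≥ 1/2 and n ≤ L(p)")] -/
theorem Werner2009_lemma62_of_half_le
    (h : ∀ ⦃ε : ℝ⦄, 0 < ε → ε < 1 / 2 →
      ∃ r₁ : ℕ, ∀ r₀ ≥ r₁, ∃ n₁ : ℕ, ∃ δ > (0 : ℝ), ∃ c > (0 : ℝ), ∃ C : ℝ,
        ∀ t : unitInterval, 1 / 2 ≤ (t : ℝ) → (t : ℝ) < 1 / 2 + δ →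
          ∀ N : ℕ, n₁ ≤ N → (1 / 2 < (t : ℝ) → N ≤ charLength ε t) →
            c * ((N : ℝ) ^ 2 * critFourArmProb r₀ N) ≤ rhombusPivotalSum t N ∧
              rhombusPivotalSum t N ≤ C * ((N : ℝ) ^ 2 * critFourArmProb r₀ N)) :
    Werner2009_lemma62 := by
  intro ε hε hε'
  obtain ⟨r₁, hr₁⟩ := h hε hε'
  refine ⟨r₁, fun r₀ hr₀ => ?_⟩
  obtain ⟨n₁, δ, hδ, c, hc, C, hb⟩ := hr₁ r₀ hr₀
  refine ⟨n₁, δ, hδ, c, hc, C, fun t ht N hN hNL => ?_⟩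
  obtain ⟨ht1, ht2⟩ := abs_sub_lt_iff.1 ht
  rcases le_or_gt (1 / 2 : ℝ) t with hle | hlt
  · exact hb t hle (by linarith) N hN fun h' => hNL h'.ne'
  · -- `t < 1/2`: apply the hypothesis at `1 - t` and come back by the symmetries
    have hs : ((σ t : unitInterval) : ℝ) = 1 - t := unitInterval.coe_symm_eq t
    have hb' := hb (σ t) (by rw [hs]; linarith) (by rw [hs]; linarith) N hN fun _ => by
      rw [charLength_symm]; exact hNL hlt.ne
    rwa [rhombusPivotalSum_symm] at hb'

/-- **`L_ε(p)` is non-increasing in `ε`**: for `0 < ε' ≤ ε` and `p ≠ 1/2`, `L_ε(p) ≤ L_{ε'}(p)`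
(Nolin 2008, §7.3, proof of Cor. 35 [arXiv 0711.4948: Cor. 33]: "assume that `ε ≤ ε'`, so that
`L_ε(p) ≥ L_{ε'}(p)`"): the scale `L_{ε'}(p)` already has sub-critical crossing probability
`≤ ε' ≤ ε`. (The finiteness of `L_{ε'}(p)`, i.e. the sub-critical decay `Nolin2008_subcritical_crossing`,
is taken as a hypothesis, as elsewhere in this file; it holds, `NearCriticalRSW.lean`.) It lets
estimates recorded "for every small enough `ε`" below `L_ε` serve every `ε ∈ (0, 1/2)`:
`N ≤ L_ε(t) ≤ L_{ε'}(t)` for `ε' ≤ ε`. [cite: Nolin2008, §7.3, proof of Cor. 35 (arXiv 0711.4948: Cor. 33)] -/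
theorem charLength_anti (hsub : Nolin2008_subcritical_crossing) {ε ε' : ℝ} (hε' : 0 < ε')
    (hle : ε' ≤ ε) {p : unitInterval} (hp : (p : ℝ) ≠ 1 / 2) : charLength ε p ≤ charLength ε' p := by
  -- reduce to `p < 1/2` by `L(1 - p) = L(p)`
  wlog hlt : (p : ℝ) < 1 / 2 generalizing p
  · have hgt : 1 / 2 < (p : ℝ) := lt_of_le_of_ne (not_lt.1 hlt) (Ne.symm hp)
    have hq : ((σ p : unitInterval) : ℝ) < 1 / 2 := by rw [unitInterval.coe_symm_eq]; linarith
    have := this (p := σ p) hq.ne hq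
    rwa [charLength_symm, charLength_symm] at this
  have hmem : charLength ε' p ∈ {n : ℕ | triLRCrossingProb (min p (σ p)) n n ≤ ε} := by
    rw [Set.mem_setOf_eq, min_symm_eq_self hlt.le]
    exact (triLRCrossingProb_charLength_le' hsub hε' hlt).trans hle
  exact Nat.sInf_le hmem

end Literature.Probability.Percolation
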